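import Summits.MatrixMultiplication.MatrixMultiplication.Theses.WindowedCompletionRank

/-!
# Crux `WindowCompletion` (stmt-MatrixMultiplication-5495) — `Lines/birth.lean`, the BC3 birth skeleton

Route `WindowedCompletionRank` (route-MatrixMultiplication-WindowedCompletionRank).  The crux (window-frame
thesis): for every `ε > 0` there are `n ≥ 2`, a finite abelian `G` with `|G| ≤ n^(2+ε)`, maps
`A B C : [n] → G` and a tensor `S` on `G³` with `R(S) ≤ n^ε` such that `⟨n,n,n⟩` EQUALS the window tensor
`[α b + β c = γ a] · S (γ a) (α b) (β c)`, `α = A x − B y`, `β = B y + C z`, `γ = A x + C z`.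

## The line: ONE SEED, KRONECKER POWERS, ASYMPTOTICALLY FREE COMPLETION (tensor-power trick on the frame)

A window frame `F = (n, G, A, B, C)` with a completion `S₀` determines a PARTIAL tensor `P_F` on `G³`
(entries `S₀ (g; u, v)` prescribed on the addition graph `u + v = g`: `1` on the diagonal window `D`,
`0` on the collision set `Z`; free off the graph).  The `k`-th KRONECKER POWER FRAME
`F^k = (n^k, G^k = Fin k → G, digit-wise maps x ↦ (A (x_i))_i, …)` is again a window frame, and every
tensor `S` on `(G^k)³` agreeing with `S₀^{⊗k}` on the (coordinatewise) addition graph — i.e. every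
completion of the Kronecker power `P_F^{⊗k}` of the partial tensor — completes it (`stub_powerFrame`,
provable now from `matMulTensor_pow_eq_kroneckerPow_comp`: `⟨n^k⟩ = ⟨n⟩^{⊗k}` relabelled by digits).
Hence the completion ranks `c_k(F) := crank (P_F^{⊗k})` are submultiplicative, the limit
`c̃(F) := lim_k c_k(F)^{1/k}` exists (Fekete), and a FULL-WINDOW seed (`|G| = n²`, forced anyway from
below by injectivity) with `c̃(F) = 1` — completions of the power patterns of rank `n^{o(k)}` — gives, at
size `N = n^k`, a frame with `|G^k| = N²` and `R(S) ≤ N^{o(1)}`: that is `WindowCompletion`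
(`windowCompletion_core`, sorry-free).  The open content is therefore concentrated in ONE finite object:

* `stub_seedAsymptoticCompletion` — **there is a full-window seed frame whose partial tensor has
  asymptotic completion rank one**: `∃ (n ≥ 2, G, |G| = n², A, B, C, S₀)` satisfying the window equation
  such that for every `δ > 0` some Kronecker power pattern `P_F^{⊗k}` (`k ≥ 1`) has a completion of rank
  `≤ n^(k·δ)`.  STRICTLY STRONGER than the crux (one seed and its powers instead of an arbitrary family;
  the crux is not known to imply it), structurally different (a single-number target `c̃(F) = 1` for a
  fixed finite partial tensor, the analogue of `R̃(⟨2,2,2⟩) = 4 ⟺ ω = 2`), and attackable where the crux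
  is not: sub-multiplicativity/Fekete, symmetry-restricted search on the elementary-abelian power frames
  `G^k = 𝔽_p^{2k}` (affine group acting), and finite computations at small `k` (the `n = 2` seeds give a
  `16 × 16 × 16` partial tensor at `k = 2`: is `crank < 4`? at `k = 3`: is `crank < 8`? — the route's
  `DelegationBound` mechanism, transplanted to the direct sum `𝔽₂³ = X₀ ⊕ Y₀ ⊕ Z₀`, predicts `≤ 7`;
  unverified here).  Size XL / open-problem.
* `stub_powerFrame` — **Kronecker closure of window frames** (the transfer machinery): completions of
  `P_F^{⊗k}` satisfy the window equation of the power frame `F^k` at size `n^k`.  Size S/M, provable now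
  (`matMulTensor_pow_eq_kroneckerPow_comp`, `Finset.prod` bookkeeping, one `funext` on `Fin k → G`).
* `windowCompletion_core : <stub₁-sig> → <stub₂-sig> → (the crux, unfolded)` — the real proof
  (`N = n^k`, `|G^k| = (n²)^k = N² ≤ N^(2+ε)`, `n^(k·ε) = N^ε`; sorry-free, standard axioms), the
  `example : <stub₁-sig> → <stub₂-sig> → WindowCompletion := windowCompletion_core` (crux by name), and
  THE registered skeleton theorem `WindowCompletion_of : WindowCompletion := windowCompletion_core
  stub_seedAsymptoticCompletion stub_powerFrame` (hypothesis-free, fed with the two declared stubs).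

Honest status.  Stub 2 is a theorem; stub 1 implies the crux (this file) and is implied by nothing
known; `WindowSqrtBarrier` (route item 5493, open) would give `c_k(F) ≥ n^{k/2}`, i.e. `c̃(F) ≥ √n`, and
refute stub 1 together with the crux — the route's declared kill structure is inherited unchanged.
Disproof used: none exists (`ledger crux ls stmt-MatrixMultiplication-5495`: no workfiles, no
`Disproof.lean`, no `Negative/`); `ledger negatives --problem MatrixMultiplication`: nothing on window /
completion rank.  Sanity (sorry-free, § Seed): the `n = 2` full-window seed over `𝔽₂²` with the trivial
completion satisfies the window equation, and its first power pattern has the rank-`2` completion — the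
body of stub 1 at `δ = 1` is inhabited, so the stub is not vacuous-in-kind and the slot conventions of
`matMulTensor` (`((x,z),(x,y),(y,z))`) match the CU form.
-/

-- `Summit.<Summit>.<Problem>`: for the single-conjunct summit the duplicate component is mandated.
set_option linter.dupNamespace false

noncomputable section

namespace Summit.MatrixMultiplication.MatrixMultiplication.Cruxes.WindowCompletion.Birth

open scoped BigOperators
open Literature.Computability.AlgebraicComplexity

/-! ## The two registered stubs -/

/-- **Stub 1 — a full-window seed with asymptotically free completion** (the engine; the crux moved to
`C⁺`): there are `n ≥ 2`, a finite abelian group `G` of order EXACTLY `n²`, maps `A B C : Fin n → G` and a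
seed completion `S₀` satisfying the window equation `⟨n,n,n⟩ = [αb + βc = γa]·S₀(γa, αb, βc)`, such that
for every `δ > 0` some Kronecker power (`k ≥ 1`) of the seed's partial tensor — the tensor on
`(Fin k → G)³` prescribed to be `∏ᵢ S₀ (g i) (u i) (v i)` on the coordinatewise addition graph
`u + v = g`, free elsewhere — has a completion `S` of rank `R(S) ≤ n^(k·δ)`.  Equivalently: the seed's
asymptotic completion rank `lim_k crank(P^{⊗k})^{1/k}` equals `1`.  Strictly stronger than the crux;
size XL / open-problem.  Sources: CohnUmans2003 (Lemma 3.1: `c = 1` impossible for abelian `G`),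
arXiv:1207.6528 (s-rank: the dual relaxation), arXiv:1612.01527 (orbit-structured algorithms),
Blaser2013 (§7, tensor powers), Strassen1988 (asymptotic spectrum / Fekete). -/
theorem stub_seedAsymptoticCompletion :
    ∃ n : ℕ, 2 ≤ n ∧ ∃ (G : Type) (_ : AddCommGroup G) (_ : Fintype G) (_ : DecidableEq G),
      Fintype.card G = n ^ 2 ∧
      ∃ (A B C : Fin n → G) (S₀ : G → G → G → ℂ),
        (Literature.Computability.AlgebraicComplexity.matMulTensor ℂ n n n = fun a b c =>
          if (A b.1 - B b.2) + (B c.1 + C c.2) = A a.1 + C a.2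
          then S₀ (A a.1 + C a.2) (A b.1 - B b.2) (B c.1 + C c.2) else 0) ∧
        ∀ δ : ℝ, 0 < δ → ∃ k : ℕ, 1 ≤ k ∧
          ∃ S : (Fin k → G) → (Fin k → G) → (Fin k → G) → ℂ,
            (∀ g u v : Fin k → G, u + v = g → S g u v = ∏ i, S₀ (g i) (u i) (v i)) ∧
            (Literature.Computability.AlgebraicComplexity.tensorRank S : ℝ) ≤ (n : ℝ) ^ ((k : ℝ) * δ) := by
  sorry

/-- **Stub 2 — Kronecker closure of window frames** (transfer machinery, provable now): if `S₀`
completes the window frame `(n, G, A, B, C)` and `S` agrees with `S₀^{⊗k}` on the coordinatewise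
addition graph of `G^k = Fin k → G`, then `S` completes the `k`-th power frame: size `n^k`, group
`Fin k → G`, digit-wise maps `A' x = (A (x_i))_i`, `B'`, `C'` (digits by `finFunctionFinEquiv.symm`).
Proof sketch: `⟨n^k⟩ = ⟨n⟩^{⊗k}` relabelled by digit pairs (`matMulTensor_pow_eq_kroneckerPow_comp`);
the window condition on `Fin k → G` is the conjunction of the digit conditions (`funext`); on it `S`
is the product of the seed window entries, i.e. of the digit entries of `⟨n⟩`; off it some digit
condition fails, that digit entry of `⟨n⟩` is `0` by the seed equation, and so is the product.
Size S/M.  Sources: Blaser2013 (§7, `⟨n⟩^{⊗k} ≅ ⟨n^k⟩`), AlmanDuanVassilevskaWilliamsXuXuZhou2025 (§3.4),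
CohnUmans2003. -/
theorem stub_powerFrame :
    ∀ (n k : ℕ) (G : Type) [AddCommGroup G] [Fintype G] [DecidableEq G]
      (A B C : Fin n → G) (S₀ : G → G → G → ℂ)
      (S : (Fin k → G) → (Fin k → G) → (Fin k → G) → ℂ)
      (A' B' C' : Fin (n ^ k) → (Fin k → G)),
      (Literature.Computability.AlgebraicComplexity.matMulTensor ℂ n n n = fun a b c =>
          if (A b.1 - B b.2) + (B c.1 + C c.2) = A a.1 + C a.2
          then S₀ (A a.1 + C a.2) (A b.1 - B b.2) (B c.1 + C c.2) else 0) →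
      (∀ g u v : Fin k → G, u + v = g → S g u v = ∏ i, S₀ (g i) (u i) (v i)) →
      (∀ x i, A' x i = A (finFunctionFinEquiv.symm x i)) →
      (∀ x i, B' x i = B (finFunctionFinEquiv.symm x i)) →
      (∀ x i, C' x i = C (finFunctionFinEquiv.symm x i)) →
      Literature.Computability.AlgebraicComplexity.matMulTensor ℂ (n ^ k) (n ^ k) (n ^ k) =
        fun a b c =>
          if (A' b.1 - B' b.2) + (B' c.1 + C' c.2) = A' a.1 + C' a.2
          then S (A' a.1 + C' a.2) (A' b.1 - B' b.2) (B' c.1 + C' c.2) else 0 := by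
  sorry

/-! ## The composition: the two stub statements prove the crux BY NAME -/

/-- **Core of the composition** (sorry-free; conclusion = the crux UNFOLDED, so that the only theorem
concluding the crux by name is the hypothesis-free `WindowCompletion_of` below, the shape the skeleton
checker registers): given `ε > 0`, take the seed `(n, G, A, B, C, S₀)` and, with `δ = ε`, a
completion `S` of the `k`-th power pattern of rank `≤ n^(k·ε)`; the power frame at size `N = n^k ≥ 2`
over `G^k = Fin k → G` has `|G^k| = (n²)^k = N² ≤ N^(2+ε)` and `R(S) ≤ n^(k·ε) = N^ε`, and `S`
satisfies its window equation by the closure stub. [folklore] -/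
theorem windowCompletion_core
    (stub_seedAsymptoticCompletion :
      (∃ n : ℕ, 2 ≤ n ∧ ∃ (G : Type) (_ : AddCommGroup G) (_ : Fintype G) (_ : DecidableEq G),
      Fintype.card G = n ^ 2 ∧
      ∃ (A B C : Fin n → G) (S₀ : G → G → G → ℂ),
        (Literature.Computability.AlgebraicComplexity.matMulTensor ℂ n n n = fun a b c =>
          if (A b.1 - B b.2) + (B c.1 + C c.2) = A a.1 + C a.2
          then S₀ (A a.1 + C a.2) (A b.1 - B b.2) (B c.1 + C c.2) else 0) ∧
        ∀ δ : ℝ, 0 < δ → ∃ k : ℕ, 1 ≤ k ∧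
          ∃ S : (Fin k → G) → (Fin k → G) → (Fin k → G) → ℂ,
            (∀ g u v : Fin k → G, u + v = g → S g u v = ∏ i, S₀ (g i) (u i) (v i)) ∧
            (Literature.Computability.AlgebraicComplexity.tensorRank S : ℝ) ≤ (n : ℝ) ^ ((k : ℝ) * δ)))
    (stub_powerFrame :
      (∀ (n k : ℕ) (G : Type) [AddCommGroup G] [Fintype G] [DecidableEq G]
      (A B C : Fin n → G) (S₀ : G → G → G → ℂ)
      (S : (Fin k → G) → (Fin k → G) → (Fin k → G) → ℂ)
      (A' B' C' : Fin (n ^ k) → (Fin k → G)),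
      (Literature.Computability.AlgebraicComplexity.matMulTensor ℂ n n n = fun a b c =>
          if (A b.1 - B b.2) + (B c.1 + C c.2) = A a.1 + C a.2
          then S₀ (A a.1 + C a.2) (A b.1 - B b.2) (B c.1 + C c.2) else 0) →
      (∀ g u v : Fin k → G, u + v = g → S g u v = ∏ i, S₀ (g i) (u i) (v i)) →
      (∀ x i, A' x i = A (finFunctionFinEquiv.symm x i)) →
      (∀ x i, B' x i = B (finFunctionFinEquiv.symm x i)) →
      (∀ x i, C' x i = C (finFunctionFinEquiv.symm x i)) →
      Literature.Computability.AlgebraicComplexity.matMulTensor ℂ (n ^ k) (n ^ k) (n ^ k) =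
        fun a b c =>
          if (A' b.1 - B' b.2) + (B' c.1 + C' c.2) = A' a.1 + C' a.2
          then S (A' a.1 + C' a.2) (A' b.1 - B' b.2) (B' c.1 + C' c.2) else 0)) :
    ∀ ε : ℝ, 0 < ε → ∃ n : ℕ, 2 ≤ n ∧ ∃ (G : Type) (_ : AddCommGroup G) (_ : Fintype G) (_ : DecidableEq G),
      (Fintype.card G : ℝ) ≤ (n : ℝ) ^ (2 + ε) ∧ ∃ (A B C : Fin n → G) (S : G → G → G → ℂ),
        (Literature.Computability.AlgebraicComplexity.tensorRank S : ℝ) ≤ (n : ℝ) ^ ε ∧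
        Literature.Computability.AlgebraicComplexity.matMulTensor ℂ n n n = fun a b c =>
          if (A b.1 - B b.2) + (B c.1 + C c.2) = A a.1 + C a.2
          then S (A a.1 + C a.2) (A b.1 - B b.2) (B c.1 + C c.2) else 0 := by
  intro ε hε
  obtain ⟨n, hn, G, instG, instF, instD, hcard, A, B, C, S₀, hEq, hRate⟩ := stub_seedAsymptoticCompletion
  obtain ⟨k, hk, S, hAgree, hRank⟩ := hRate ε hε
  -- the power frame at size `N = n ^ k`
  have hk0 : k ≠ 0 := Nat.one_le_iff_ne_zero.mp hk
  have hN : 2 ≤ n ^ k := hn.trans (Nat.le_self_pow hk0 n)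
  have hN1 : (1 : ℝ) ≤ ((n ^ k : ℕ) : ℝ) := by exact_mod_cast (le_trans (by norm_num) hN)
  have hn0 : (0 : ℝ) ≤ (n : ℝ) := Nat.cast_nonneg n
  -- digit-wise maps
  let A' : Fin (n ^ k) → (Fin k → G) := fun x i => A (finFunctionFinEquiv.symm x i)
  let B' : Fin (n ^ k) → (Fin k → G) := fun x i => B (finFunctionFinEquiv.symm x i)
  let C' : Fin (n ^ k) → (Fin k → G) := fun x i => C (finFunctionFinEquiv.symm x i)
  -- |G^k| = (n²)^k = (n^k)² ≤ (n^k)^(2+ε)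
  have hcardPow : (Fintype.card (Fin k → G) : ℝ) ≤ ((n ^ k : ℕ) : ℝ) ^ (2 + ε) := by
    have h1 : Fintype.card (Fin k → G) = (n ^ k) ^ 2 := by
      rw [Fintype.card_fun, Fintype.card_fin, hcard, ← pow_mul, ← pow_mul, mul_comm]
    rw [h1]
    calc (((n ^ k) ^ 2 : ℕ) : ℝ) = ((n ^ k : ℕ) : ℝ) ^ (2 : ℝ) := by
          rw [Real.rpow_two]; push_cast; ring
      _ ≤ ((n ^ k : ℕ) : ℝ) ^ (2 + ε) :=
          Real.rpow_le_rpow_of_exponent_le hN1 (by linarith)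
  -- R(S) ≤ n^(k·ε) = (n^k)^ε
  have hRank' : (Literature.Computability.AlgebraicComplexity.tensorRank S : ℝ) ≤
      ((n ^ k : ℕ) : ℝ) ^ ε := by
    refine hRank.trans (le_of_eq ?_)
    rw [Real.rpow_mul hn0, Real.rpow_natCast, Nat.cast_pow]
  -- the window equation of the power frame (closure stub)
  have hEqPow := stub_powerFrame n k G A B C S₀ S A' B' C' hEq hAgree (fun _ _ => rfl)
    (fun _ _ => rfl) (fun _ _ => rfl)
  exact ⟨n ^ k, hN, (Fin k → G), inferInstance, inferInstance, inferInstance, hcardPow,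
    A', B', C', S, hRank', hEqPow⟩

/-- **THE SKELETON THEOREM (registered).** The crux
`Summit.MatrixMultiplication.MatrixMultiplication.Theses.WindowedCompletionRank.WindowCompletion`
(stmt-MatrixMultiplication-5495) BY NAME — the only theorem of this file concluding it, hypothesis-free,
from the two DECLARED stubs by name through the sorry-free `windowCompletion_core` (so it is closed only
through the stubs' `sorry`s; this is the shape `ledger skeleton check` registers and the line's provers
discharge stub by stub).  The conditional reading `<stub₁-sig> → <stub₂-sig> → WindowCompletion` is
`windowCompletion_core` itself, kernel-checked against the crux by name in the `example` right below.
[folklore] -/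
theorem WindowCompletion_of :
    Summit.MatrixMultiplication.MatrixMultiplication.Theses.WindowedCompletionRank.WindowCompletion :=
  windowCompletion_core stub_seedAsymptoticCompletion stub_powerFrame

/-- The conditional shape `<stub₁-sig> → <stub₂-sig> → WindowCompletion` (crux by name), sorry-free: an
`example`, so that `WindowCompletion_of` stays the unique registered skeleton theorem. [folklore] -/
example :
    (∃ n : ℕ, 2 ≤ n ∧ ∃ (G : Type) (_ : AddCommGroup G) (_ : Fintype G) (_ : DecidableEq G),
      Fintype.card G = n ^ 2 ∧
      ∃ (A B C : Fin n → G) (S₀ : G → G → G → ℂ),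
        (Literature.Computability.AlgebraicComplexity.matMulTensor ℂ n n n = fun a b c =>
          if (A b.1 - B b.2) + (B c.1 + C c.2) = A a.1 + C a.2
          then S₀ (A a.1 + C a.2) (A b.1 - B b.2) (B c.1 + C c.2) else 0) ∧
        ∀ δ : ℝ, 0 < δ → ∃ k : ℕ, 1 ≤ k ∧
          ∃ S : (Fin k → G) → (Fin k → G) → (Fin k → G) → ℂ,
            (∀ g u v : Fin k → G, u + v = g → S g u v = ∏ i, S₀ (g i) (u i) (v i)) ∧
            (Literature.Computability.AlgebraicComplexity.tensorRank S : ℝ) ≤ (n : ℝ) ^ ((k : ℝ) * δ)) →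
    (∀ (n k : ℕ) (G : Type) [AddCommGroup G] [Fintype G] [DecidableEq G]
      (A B C : Fin n → G) (S₀ : G → G → G → ℂ)
      (S : (Fin k → G) → (Fin k → G) → (Fin k → G) → ℂ)
      (A' B' C' : Fin (n ^ k) → (Fin k → G)),
      (Literature.Computability.AlgebraicComplexity.matMulTensor ℂ n n n = fun a b c =>
          if (A b.1 - B b.2) + (B c.1 + C c.2) = A a.1 + C a.2
          then S₀ (A a.1 + C a.2) (A b.1 - B b.2) (B c.1 + C c.2) else 0) →
      (∀ g u v : Fin k → G, u + v = g → S g u v = ∏ i, S₀ (g i) (u i) (v i)) →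
      (∀ x i, A' x i = A (finFunctionFinEquiv.symm x i)) →
      (∀ x i, B' x i = B (finFunctionFinEquiv.symm x i)) →
      (∀ x i, C' x i = C (finFunctionFinEquiv.symm x i)) →
      Literature.Computability.AlgebraicComplexity.matMulTensor ℂ (n ^ k) (n ^ k) (n ^ k) =
        fun a b c =>
          if (A' b.1 - B' b.2) + (B' c.1 + C' c.2) = A' a.1 + C' a.2
          then S (A' a.1 + C' a.2) (A' b.1 - B' b.2) (B' c.1 + C' c.2) else 0) →
    Summit.MatrixMultiplication.MatrixMultiplication.Theses.WindowedCompletionRank.WindowCompletion :=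
  windowCompletion_core

/-! ## Seed sanity (sorry-free): the `n = 2` full window over `𝔽₂²`

The body of `stub_seedAsymptoticCompletion` with `∀ δ > 0` specialised to `δ = 1` is inhabited by the
`n = 2` full-window seed `G = 𝔽₂²`, `A x = (x,0)`, `B y = (y,y)`, `C z = (0,z)` with the trivial
completion `T (g; u, v) = [u₂ + v₁ = 0]` and its first power (`k = 1`, rank `2 = n^(1·1)`).  So the seed
conjunct is satisfiable (the slot convention `((x,z),(x,y),(y,z))` of `matMulTensor` matches the CU form)
and the stub is not false for a trivial reason; its content is `δ → 0`. -/

/-- Seed map `A x = (x, 0)` into `𝔽₂² = Fin 2 × Fin 2`. [folklore] -/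
def A₂ : Fin 2 → Fin 2 × Fin 2 := fun x => (x, 0)
/-- Seed map `B y = (y, y)`. [folklore] -/
def B₂ : Fin 2 → Fin 2 × Fin 2 := fun y => (y, y)
/-- Seed map `C z = (0, z)`. [folklore] -/
def C₂ : Fin 2 → Fin 2 × Fin 2 := fun z => (0, z)
/-- The trivial completion `T (g; u, v) = [u₂ + v₁ = 0]` (constant in the output leg). [folklore] -/
def T₂ : Fin 2 × Fin 2 → Fin 2 × Fin 2 → Fin 2 × Fin 2 → ℂ :=
  fun _ u v => if u.2 + v.1 = 0 then 1 else 0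

/-- The `n = 2` seed satisfies the window equation `⟨2,2,2⟩ = [αb + βc = γa]·T(γa, αb, βc)`. [folklore] -/
theorem seed_two_window :
    Literature.Computability.AlgebraicComplexity.matMulTensor ℂ 2 2 2 = fun a b c =>
      if (A₂ b.1 - B₂ b.2) + (B₂ c.1 + C₂ c.2) = A₂ a.1 + C₂ a.2
      then T₂ (A₂ a.1 + C₂ a.2) (A₂ b.1 - B₂ b.2) (B₂ c.1 + C₂ c.2) else 0 := by
  have key : ∀ a b c : Fin 2 × Fin 2,
      ((a.1 = b.1 ∧ b.2 = c.1 ∧ a.2 = c.2) ↔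
        ((A₂ b.1 - B₂ b.2) + (B₂ c.1 + C₂ c.2) = A₂ a.1 + C₂ a.2 ∧
          (A₂ b.1 - B₂ b.2).2 + (B₂ c.1 + C₂ c.2).1 = 0)) := by
    decide
  funext a b c
  simp only [Literature.Computability.AlgebraicComplexity.matMulTensor, T₂]
  by_cases h : a.1 = b.1 ∧ b.2 = c.1 ∧ a.2 = c.2
  · obtain ⟨h1, h2⟩ := (key a b c).mp h
    rw [if_pos h, if_pos h1, if_pos h2]
  · rw [if_neg h]
    by_cases h1 : (A₂ b.1 - B₂ b.2) + (B₂ c.1 + C₂ c.2) = A₂ a.1 + C₂ a.2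
    · rw [if_pos h1, if_neg (fun h2 => h ((key a b c).mpr ⟨h1, h2⟩))]
    · rw [if_neg h1]

/-- The first power (`k = 1`) of the seed pattern has the rank-`2` completion `T^{⊗1}`:
`[u₂ + v₁ = 0] = ∑_{t ∈ 𝔽₂} [u₂ = t]·[t + v₁ = 0]`. [folklore] -/
theorem seed_two_powOne_rank :
    Literature.Computability.AlgebraicComplexity.tensorRank
        (fun g u v : Fin 1 → Fin 2 × Fin 2 => ∏ i, T₂ (g i) (u i) (v i)) ≤ 2 := by
  refine Literature.Computability.AlgebraicComplexity.tensorRank_le_of_eq_sum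
    (fun _ _ => (1 : ℂ)) (fun t u => if (u 0).2 = t then 1 else 0)
    (fun t v => if t + (v 0).1 = 0 then 1 else 0) ?_
  funext g u v
  rw [Finset.sum_apply, Finset.sum_apply, Finset.sum_apply]
  simp only [Literature.Computability.AlgebraicComplexity.triad_apply, Fin.prod_univ_one, T₂, one_mul]
  rw [Fin.sum_univ_two]
  have h2 : ∀ t : Fin 2, t = 0 ∨ t = 1 := by decide
  rcases h2 (u 0).2 with hu | hu <;> rcases h2 (v 0).1 with hv | hv <;> simp [hu, hv]

/-- **Non-vacuity of the seed stub in kind**: the body of `stub_seedAsymptoticCompletion` at `δ = 1`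
holds (seed `n = 2` over `𝔽₂²`, `k = 1`, completion `T^{⊗1}` of rank `≤ 2 = 2^(1·1)`). [folklore] -/
theorem seed_body_at_one :
    ∃ n : ℕ, 2 ≤ n ∧ ∃ (G : Type) (_ : AddCommGroup G) (_ : Fintype G) (_ : DecidableEq G),
      Fintype.card G = n ^ 2 ∧
      ∃ (A B C : Fin n → G) (S₀ : G → G → G → ℂ),
        (Literature.Computability.AlgebraicComplexity.matMulTensor ℂ n n n = fun a b c =>
          if (A b.1 - B b.2) + (B c.1 + C c.2) = A a.1 + C a.2
          then S₀ (A a.1 + C a.2) (A b.1 - B b.2) (B c.1 + C c.2) else 0) ∧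
        ∃ k : ℕ, 1 ≤ k ∧
          ∃ S : (Fin k → G) → (Fin k → G) → (Fin k → G) → ℂ,
            (∀ g u v : Fin k → G, u + v = g → S g u v = ∏ i, S₀ (g i) (u i) (v i)) ∧
            (Literature.Computability.AlgebraicComplexity.tensorRank S : ℝ) ≤ (n : ℝ) ^ ((k : ℝ) * 1) := by
  refine ⟨2, le_rfl, Fin 2 × Fin 2, inferInstance, inferInstance, inferInstance, by simp, A₂, B₂, C₂, T₂,
    seed_two_window, 1, le_rfl, fun g u v => ∏ i, T₂ (g i) (u i) (v i), fun _ _ _ _ => rfl, ?_⟩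
  have h := seed_two_powOne_rank
  calc (Literature.Computability.AlgebraicComplexity.tensorRank
          (fun g u v : Fin 1 → Fin 2 × Fin 2 => ∏ i, T₂ (g i) (u i) (v i)) : ℝ) ≤ 2 := by
        exact_mod_cast h
    _ = ((2 : ℕ) : ℝ) ^ (((1 : ℕ) : ℝ) * 1) := by norm_num

end Summit.MatrixMultiplication.MatrixMultiplication.Cruxes.WindowCompletion.Birth

end
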